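import Literature.NumberTheory.Automorphic.CDTTheorem712
import Literature.NumberTheory.EllipticCurves.ModFiveCongruenceHesseFamily
import Literature.NumberTheory.EllipticCurves.GaloisActionProofs
import Literature.NumberTheory.EllipticCurves.GeomPointReduction
import Literature.NumberTheory.EllipticCurves.VariableChangePoints
import Literature.NumberTheory.GaloisRepresentations.AbsGaloisGroup
import Mathlib.FieldTheory.RatFunc.AsPolynomial
import Mathlib.FieldTheory.RatFunc.IntermediateField
import Mathlib.RingTheory.DedekindDomain.AdicValuation
import HarnessLib

/-!
# stub-ideation k1 · GENERATION 14 (home FAMILY 1 — recognise & import) — `stub_switch`, crux `FreyModularity`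

**F1 (= Fisher 13.2(i), `thm132_geomTorsionFive_of_hesseFamily`) BY RUBIN–SILVERBERG SPECIALISATION,
REALISED AS THE TREE'S `goodReductionHom` AT THE PLACE `t = t₀` OF `ℚ̄(t)`.**
Namespace `…Cruxes.FreyModularity.StubSwitchK1g14`.  Companion of `STUB-IDEAS-stub_switch-1.md`.

`stub_switch ↔ CDT_three_five_switch` (`Iff.rfl`, `Lines/Sketch.lean`), and k3-g11's kernel-checked road
`CDT_three_five_switch_of_thm132 : F1 → CDT_three_five_switch` (`STUB_IDEAS_stub_switch_3g11_Road.lean`,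
0 sorries) leaves exactly F1.  Rubin–Silverberg (*Mod 5 representations*, Prop. 2.1 / Cor. 2.2, in
Coates–Yau 1997 p. 188): for the one-parameter family `𝒢_t` (Fisher's segment `(λ:μ) = (1−t+tl : tm)`,
`𝒢_0 = E`, `𝒢_1 = E'`) the 5-torsion `V := 𝒢(ℚ̄(t))[5]` of the GENERIC fibre has 25 points, and for
every rational `t₀` with `Δ(𝒢_{t₀}) ≠ 0` the specialisation `V → 𝒢_{t₀}(ℚ̄)[5]` is a `Γ_ℚ`-equivariant group
isomorphism; `e := sp₀ ∘ sp₁⁻¹` is the congruence `E'[5] ≃ E[5]`.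

THE IMPORT: the specialisation map IS the tree's reduction homomorphism `goodReductionHom`
(`GeomPointReduction`, Silverman VII.2.1) for the valuation ring `𝒪_{t₀} ⊂ ℚ̄(t)` of the `(t − t₀)`-adic
valuation (Mathlib `IsDedekindDomain.HeightOneSpectrum.valuation`, pattern of `Polynomial.idealX`):
additivity is FREE, injectivity on `V` is FREE (`eq_zero_of_zsmul_eq_zero_of_goodReductionHom_eq_zero`,
VII.3.1(b), `v(5) = 1`), `#𝒢_{t₀}[5] = 25` is FREE (`card_torsionBy_eq_sq`).  `#V ≥ 25` comes from TWO
universal sections of the Klein family `B_u : y² = x³ − 27c₄(1,u)x − 54c₆(1,u)`: `Q = (x₁(u), y₁(u))`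
of order 5 (doubling chain `2Q = (x₂,y₂)`, `4Q = −Q`, four `ring` identities) and `R = Q(ζ₅u)`
(`c₄(1,ζu) = c₄(1,u)`), `R ∉ ⟨Q⟩` by ONE coefficient (`u⁸`: `36ζ³ ∉ {36, 72}`); they are transported to
`𝒢` over `K = ℚ̄(t)` by Fisher's Lemma 8.4 (`𝒢 ≅_K` scaled `B_u`, `u = b(t)/a(t)`, `(a,b) = M_v(λ,μ)`,
torsor point `v` — k3 PROVED `lemma84_C4`, `exists_torsorPoint`, the syzygies; `𝔠₆` is needed only UP TO
SIGN, which the syzygies give, the sign being absorbed by the `i`-scaling — so k3's OPEN `L84C6` is NOT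
used).  Sorries below are ONLY in helper lemmas; items marked PROVED-ELSEWHERE are restated because crux
workfiles do not import each other.
-/

open scoped Classical
noncomputable section
set_option linter.dupNamespace false
open Polynomial

namespace Summit.ABC.ABC.Cruxes.FreyModularity.StubSwitchK1g14

open Literature.NumberTheory.EllipticCurves Literature.NumberTheory.EllipticCurves.HesseFamilyFive
open Literature.NumberTheory.Automorphic.BCDT WeierstrassCurve

local notation "𝕃" => AlgebraicClosure ℚ

attribute [-instance] DivisionRing.toRatAlgebra

/-! ## §P  The place `t = t₀` of `𝕜(t)` and evaluation (generic field `𝕜`; pure Mathlib; all S/XS) -/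

section Place

variable {𝕜 : Type*} [Field 𝕜]

/-- P1 · `(X − t₀)` as a height-one prime of `𝕜[X]` (copy of Mathlib's `Polynomial.idealX`). -/
def idealXSubC (t₀ : 𝕜) : IsDedekindDomain.HeightOneSpectrum 𝕜[X] where
  asIdeal := Ideal.span {X - C t₀}
  isPrime := by
    rw [Ideal.span_singleton_prime]; exacts [Polynomial.prime_X_sub_C t₀, Polynomial.X_sub_C_ne_zero t₀]
  ne_bot := by rw [ne_eq, Ideal.span_singleton_eq_bot]; exact Polynomial.X_sub_C_ne_zero t₀

/-- P2 · the `(t − t₀)`-adic valuation ring `𝒪_{t₀} = 𝕜[t]_{(t − t₀)} ⊂ 𝕜(t)`. -/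
noncomputable def placeAt (t₀ : 𝕜) : ValuationSubring (RatFunc 𝕜) :=
  ((idealXSubC t₀).valuation (RatFunc 𝕜)).valuationSubring

/-- P3 (XS, verbatim `integers_placeOver`) · the `hv` hypothesis of `goodReductionHom`. -/
theorem integers_placeAt (t₀ : 𝕜) : (placeAt t₀).valuation.Integers (placeAt t₀) where
  hom_inj := Subtype.coe_injective
  map_le_one a := (placeAt t₀).valuation_le_one a
  exists_of_le_one x hx := ⟨⟨x, ((placeAt t₀).valuation_le_one_iff x).mp hx⟩, rfl⟩

/-- P4 (XS, `HeightOneSpectrum.valuation_le_one`) · polynomials are `t₀`-integral. -/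
theorem algebraMap_mem_placeAt (t₀ : 𝕜) (p : 𝕜[X]) :
    algebraMap 𝕜[X] (RatFunc 𝕜) p ∈ placeAt t₀ := by
  first
  | exact (Valuation.mem_valuationSubring_iff _ _).mpr ((idealXSubC t₀).valuation_le_one _ _)
  | exact (Valuation.mem_valuationSubring_iff _ _).mpr ((idealXSubC t₀).valuation_le_one _)

/-- P5 · `𝕜[t] → 𝒪_{t₀}`. -/
noncomputable def toPlace (t₀ : 𝕜) : 𝕜[X] →+* placeAt t₀ :=
  (algebraMap 𝕜[X] (RatFunc 𝕜)).codRestrict (placeAt t₀) (algebraMap_mem_placeAt t₀)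

/-- P6 (S, `valuation_lt_one_iff_dvd` + `num_div_denom`, `isCoprime_num_denom`) · membership test. -/
theorem mem_placeAt_iff (t₀ : 𝕜) (f : RatFunc 𝕜) : f ∈ placeAt t₀ ↔ f.denom.eval t₀ ≠ 0 := by
  sorry

/-- P7 (S) · a nonzero constant (e.g. `5`) is a `t₀`-unit: the `hn : v n = 1` hypothesis of
`eq_zero_of_zsmul_eq_zero_of_goodReductionHom_eq_zero`. -/
theorem valuation_placeAt_intCast [CharZero 𝕜] (t₀ : 𝕜) {n : ℤ} (hn : n ≠ 0) :
    (placeAt t₀).valuation (n : RatFunc 𝕜) = 1 := by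
  sorry

/-- P8 (S, `RatFunc.eval_add/eval_mul` with P6) · EVALUATION AT `t₀` on the valuation ring
(`f ↦ f(t₀)`; well defined exactly on `𝒪_{t₀}`). -/
noncomputable def evalPlace (t₀ : 𝕜) : placeAt t₀ →+* 𝕜 where
  toFun f := RatFunc.eval (RingHom.id 𝕜) t₀ (f : RatFunc 𝕜)
  map_one' := by simp
  map_zero' := by simp
  map_mul' f g := by sorry
  map_add' f g := by sorry

/-- P9 (XS, `RatFunc.eval_algebraMap`). -/
theorem evalPlace_toPlace (t₀ : 𝕜) (p : 𝕜[X]) : evalPlace t₀ (toPlace t₀ p) = p.eval t₀ := by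
  show RatFunc.eval (RingHom.id 𝕜) t₀ (algebraMap 𝕜[X] (RatFunc 𝕜) p) = _
  rw [RatFunc.eval_algebraMap]
  rfl

/-- P10 (S) · `ker (evalPlace) = 𝔪_{t₀}`, i.e. `evalPlace` is a local hom onto the residue field. -/
theorem isLocalHom_evalPlace (t₀ : 𝕜) : IsLocalHom (evalPlace t₀) := by
  sorry

/-- P11 · the residue field of `𝒪_{t₀}` mapped (injectively) to `𝕜` (Mathlib `ResidueField.lift`). -/
noncomputable def residueLift (t₀ : 𝕜) : IsLocalRing.ResidueField (placeAt t₀) →+* 𝕜 :=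
  @IsLocalRing.ResidueField.lift _ _ _ _ _ (evalPlace t₀) (isLocalHom_evalPlace t₀)

theorem residueLift_comp_residue (t₀ : 𝕜) :
    (residueLift t₀).comp (IsLocalRing.residue (placeAt t₀)) = evalPlace t₀ :=
  @IsLocalRing.ResidueField.lift_comp_residue _ _ _ _ _ (evalPlace t₀) (isLocalHom_evalPlace t₀)

/-! ## §S  SPECIALISATION of a family `𝒲 / 𝕜[t]` at `t₀` = `goodReductionHom` at the place (M− in total) -/

/-- The model of `𝒲` over `𝒪_{t₀}`. -/
noncomputable def placeModelAt (𝒲 : WeierstrassCurve 𝕜[X]) (t₀ : 𝕜) : WeierstrassCurve (placeAt t₀) :=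
  𝒲.map (toPlace t₀)

/-- S1 (XS, `map_map`) · over `𝕜(t)` the model is the generic fibre. -/
theorem placeModelAt_baseChange (𝒲 : WeierstrassCurve 𝕜[X]) (t₀ : 𝕜) :
    (placeModelAt 𝒲 t₀).baseChange (RatFunc 𝕜) = 𝒲.map (algebraMap 𝕜[X] (RatFunc 𝕜)) := by
  rw [placeModelAt, baseChange, WeierstrassCurve.map_map]
  rfl

/-- S2 (XS, `map_map` + `residueLift_comp_residue` + P9) · modulo `𝔪_{t₀}` the model is the fibre `𝒲_{t₀}`. -/
theorem placeModelAt_map_residue (𝒲 : WeierstrassCurve 𝕜[X]) (t₀ : 𝕜) :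
    ((placeModelAt 𝒲 t₀).map (IsLocalRing.residue (placeAt t₀))).map (residueLift t₀) =
      𝒲.map (evalRingHom t₀) := by
  sorry

/-- S3 (S, `ValuationSubring.valuation_eq_one_iff`, `valuation_lt_one_iff_dvd`, `dvd_iff_isRoot`) ·
good reduction at `t₀` iff the fibre is nonsingular. -/
theorem isUnit_Δ_placeModelAt (𝒲 : WeierstrassCurve 𝕜[X]) (t₀ : 𝕜)
    (hΔ : (𝒲.map (evalRingHom t₀)).Δ ≠ 0) : IsUnit (placeModelAt 𝒲 t₀).Δ := by
  sorry

/-- **S4 · THE SPECIALISATION HOMOMORPHISM `sp_{t₀} : 𝒲(𝕜(t)) →+ 𝒲_{t₀}(𝕜)`** — verbatim the shape of the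
tree's `geomReduction`: transport · `goodReductionHom` · `mapPointHom residueLift` · transport.
ADDITIVE BY CONSTRUCTION. -/
noncomputable def specialise (𝒲 : WeierstrassCurve 𝕜[X]) (t₀ : 𝕜) (hΔ : (𝒲.map (evalRingHom t₀)).Δ ≠ 0) :
    (𝒲.map (algebraMap 𝕜[X] (RatFunc 𝕜))).toAffine.Point →+ (𝒲.map (evalRingHom t₀)).toAffine.Point :=
  ((Affine.Point.congrEquiv (placeModelAt_map_residue 𝒲 t₀)).toAddMonoidHom.comp
    ((((placeModelAt 𝒲 t₀).map (IsLocalRing.residue (placeAt t₀))).mapPointHom (residueLift t₀)).comp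
      (goodReductionHom (placeModelAt 𝒲 t₀) (integers_placeAt t₀) (isUnit_Δ_placeModelAt 𝒲 t₀ hΔ)))).comp
    (Affine.Point.congrEquiv (placeModelAt_baseChange 𝒲 t₀).symm).toAddMonoidHom

/-- S5 (S, `reducePoint_some_algebraMap` + `mapPointHom_some` + `congrEquiv_some`) · on a point with
POLYNOMIAL coordinates `sp_{t₀}` is evaluation. -/
theorem specialise_some_polynomial (𝒲 : WeierstrassCurve 𝕜[X]) (t₀ : 𝕜)
    (hΔ : (𝒲.map (evalRingHom t₀)).Δ ≠ 0) (p q : 𝕜[X])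
    (h : (𝒲.map (algebraMap 𝕜[X] (RatFunc 𝕜))).toAffine.Nonsingular
      (algebraMap 𝕜[X] (RatFunc 𝕜) p) (algebraMap 𝕜[X] (RatFunc 𝕜) q)) :
    ∃ h', specialise 𝒲 t₀ hΔ (.some _ _ h) = .some (p.eval t₀) (q.eval t₀) h' := by
  sorry

/-- **S6 (S, = tree `eq_zero_of_zsmul_eq_zero_of_goodReductionHom_eq_zero` + P7 + injectivity of
`mapPointHom`/`congrEquiv`) · `sp_{t₀}` IS INJECTIVE ON `n`-TORSION** (Silverman VII.3.1(b) for the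
place `t = t₀`; `char 𝕜 = 0`). -/
theorem specialise_eq_zero [CharZero 𝕜] (𝒲 : WeierstrassCurve 𝕜[X]) (t₀ : 𝕜)
    (hΔ : (𝒲.map (evalRingHom t₀)).Δ ≠ 0) {n : ℤ} (hn : n ≠ 0)
    {P : (𝒲.map (algebraMap 𝕜[X] (RatFunc 𝕜))).toAffine.Point} (hP : n • P = 0)
    (h0 : specialise 𝒲 t₀ hΔ P = 0) : P = 0 := by
  sorry

/-- S7 (XS from S6) · injective on the `n`-torsion subgroup. -/
theorem specialise_injOn_torsion [CharZero 𝕜] (𝒲 : WeierstrassCurve 𝕜[X]) (t₀ : 𝕜)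
    (hΔ : (𝒲.map (evalRingHom t₀)).Δ ≠ 0) {n : ℤ} (hn : n ≠ 0) :
    Set.InjOn (specialise 𝒲 t₀ hΔ) {P | n • P = 0} := by
  sorry

end Place

/-! ## §G  Galois equivariance at a RATIONAL `t₀` for a family defined over `ℚ` (M−) -/

section Galois

/-- G1 (S, `Polynomial.map_ne_zero_iff` for the `nonZeroDivisors` side condition) · `σ ∈ Γ_ℚ` acting on
`ℚ̄(t)` coefficientwise. -/
noncomputable def galK (σ : Field.absoluteGaloisGroup ℚ) : RatFunc 𝕃 →+* RatFunc 𝕃 :=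
  RatFunc.mapRingHom
    (Polynomial.mapRingHom ((Field.absoluteGaloisGroup.toAlgEquiv ℚ σ).toAlgHom.toRingHom))
    (by sorry)

variable (𝒲₀ : WeierstrassCurve ℚ[X]) (t₀ : ℚ)

/-- The family over `ℚ̄[t]`. -/
noncomputable abbrev famL : WeierstrassCurve 𝕃[X] := 𝒲₀.map (Polynomial.mapRingHom (algebraMap ℚ 𝕃))

/-- G2 (XS, `map_map`; the family is defined over `ℚ`) · `σ̃` fixes the generic fibre. -/
theorem famL_generic_map_galK (σ : Field.absoluteGaloisGroup ℚ) :
    ((famL 𝒲₀).map (algebraMap 𝕃[X] (RatFunc 𝕃))).map (galK σ) =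
      (famL 𝒲₀).map (algebraMap 𝕃[X] (RatFunc 𝕃)) := by
  sorry

/-- G3 · the Galois action on generic points `P ↦ P^σ`. -/
noncomputable def galPoint (σ : Field.absoluteGaloisGroup ℚ) :
    ((famL 𝒲₀).map (algebraMap 𝕃[X] (RatFunc 𝕃))).toAffine.Point →+
      ((famL 𝒲₀).map (algebraMap 𝕃[X] (RatFunc 𝕃))).toAffine.Point :=
  (Affine.Point.congrEquiv (famL_generic_map_galK 𝒲₀ σ)).toAddMonoidHom.comp
    (((famL 𝒲₀).map (algebraMap 𝕃[X] (RatFunc 𝕃))).mapPointHom (galK σ))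

/-- G4 (XS, `map_map`, `Polynomial.eval_map`) · at a rational `t₀` the fibre is the base change of the
ℚ-curve `𝒲₀(t₀)`. -/
theorem famL_fibre (t₀ : ℚ) :
    (famL 𝒲₀).map (evalRingHom (t₀ : 𝕃)) = (𝒲₀.map (evalRingHom t₀)).baseChange 𝕃 := by
  rw [famL, baseChange, WeierstrassCurve.map_map, WeierstrassCurve.map_map]
  congr 1
  refine RingHom.ext fun p => ?_
  simp only [RingHom.coe_comp, Function.comp_apply, Polynomial.coe_evalRingHom, Polynomial.coe_mapRingHom,
    Polynomial.eval_map]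
  rw [(eq_ratCast (algebraMap ℚ (AlgebraicClosure ℚ)) t₀).symm, Polynomial.eval₂_hom]

/-- **G5 (M−) · `sp_{t₀}` IS `Γ_ℚ`-EQUIVARIANT for `t₀ ∈ ℚ`.**  Proof plan: `point_cases` for `𝒪_{t₀}`;
`σ̃` preserves `v_{t₀}` (`σ̃(t − t₀) = t − t₀`), so non-integral points go to `O` on both sides
(`goodReductionHom_eq_zero_iff`); on integral points both sides are `(σ(x(t₀)), σ(y(t₀)))` because
`evalPlace t₀ ∘ σ̃ = σ ∘ evalPlace t₀` (`Polynomial.eval_map` at the `σ`-fixed point `t₀`). -/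
theorem specialise_galPoint (σ : Field.absoluteGaloisGroup ℚ)
    (hΔ : ((famL 𝒲₀).map (evalRingHom (t₀ : 𝕃))).Δ ≠ 0)
    (P : ((famL 𝒲₀).map (algebraMap 𝕃[X] (RatFunc 𝕃))).toAffine.Point) :
    Affine.Point.congrEquiv (famL_fibre 𝒲₀ t₀) (specialise (famL 𝒲₀) (t₀ : 𝕃) hΔ (galPoint 𝒲₀ σ P)) =
      (Field.absoluteGaloisGroup.toAlgEquiv ℚ σ) •
        Affine.Point.congrEquiv (famL_fibre 𝒲₀ t₀) (specialise (famL 𝒲₀) (t₀ : 𝕃) hΔ P) := by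
  sorry

end Galois

/-! ## §K  Klein's universal family and its two 5-torsion sections (generic commutative ring; `ring`) -/

section Klein
variable {R : Type*} [CommRing R]

/-- Klein's icosahedral forms (verbatim k3). -/
def kD (a b : R) : R := a ^ 11 * b - 11 * a ^ 6 * b ^ 6 - a * b ^ 11
def kDa (a b : R) : R := 11 * a ^ 10 * b - 66 * a ^ 5 * b ^ 6 - b ^ 11
def kDb (a b : R) : R := a ^ 11 - 66 * a ^ 6 * b ^ 5 - 11 * a * b ^ 10
def kC4 (a b : R) : R :=
  a ^ 20 + 228 * a ^ 15 * b ^ 5 + 494 * a ^ 10 * b ^ 10 - 228 * a ^ 5 * b ^ 15 + b ^ 20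
def kC6 (a b : R) : R :=
  -a ^ 30 + 522 * a ^ 25 * b ^ 5 + 10005 * a ^ 20 * b ^ 10 + 10005 * a ^ 10 * b ^ 20
    - 522 * a ^ 5 * b ^ 25 - b ^ 30
def Mv1 (a b l m : R) : R := l * a - m * kDb a b
def Mv2 (a b l m : R) : R := l * b + m * kDa a b

/-- THE TWO SECTIONS (found/verified exactly in session, `scratch/klein5.py`; Rubin–Silverberg §1.2 give
the analogous `x₀, y₀` for their normalisation).  `Q = (x₁ u, y₁ u)`, `2Q = (x₂ u, y₂ u)`, tangent
slopes `l₁ u`, `l₂ u` (POLYNOMIAL — the miracle that makes everything `ring`). -/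
def x₁ (u : R) : R := 3 + 36 * u + 72 * u ^ 2 + 108 * u ^ 3 + 180 * u ^ 4 + 90 * u ^ 5 + 72 * u ^ 6
  - 36 * u ^ 7 + 36 * u ^ 8 + 3 * u ^ 10
def y₁ (u : R) : R := 108 * u + 432 * u ^ 2 + 972 * u ^ 3 + 1620 * u ^ 4 + 2700 * u ^ 5
  + 3132 * u ^ 6 + 2268 * u ^ 7 + 648 * u ^ 8 + 540 * u ^ 9 + 432 * u ^ 11 + 108 * u ^ 12 + 108 * u ^ 13
def l₁ (u : R) : R := 3 + 12 * u + 6 * u ^ 2 + 18 * u ^ 3 - 6 * u ^ 4 + 3 * u ^ 5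
def x₂ (u : R) : R := 3 + 36 * u ^ 2 + 36 * u ^ 3 + 72 * u ^ 4 - 90 * u ^ 5 + 180 * u ^ 6
  - 108 * u ^ 7 + 72 * u ^ 8 - 36 * u ^ 9 + 3 * u ^ 10
def y₂ (u : R) : R := 108 * u ^ 2 - 108 * u ^ 3 + 432 * u ^ 4 + 540 * u ^ 6 - 648 * u ^ 7
  + 2268 * u ^ 8 - 3132 * u ^ 9 + 2700 * u ^ 10 - 1620 * u ^ 11 + 972 * u ^ 12 - 432 * u ^ 13
  + 108 * u ^ 14
def l₂ (u : R) : R := 3 + 6 * u + 18 * u ^ 2 - 6 * u ^ 3 + 12 * u ^ 4 - 3 * u ^ 5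

/-- K1 · `Q` lies on `B_u : y² = x³ − 27 c₄(1,u) x − 54 c₆(1,u)`. -/
theorem cert_curve (u : R) : y₁ u ^ 2 = x₁ u ^ 3 - 27 * kC4 1 u * x₁ u - 54 * kC6 1 u := by
  simp only [x₁, y₁, kC4, kC6]; ring

/-- K2 · the tangent at `Q` and `2Q = (x₂, y₂)` (Mathlib `slope`/`addX`/`addY` for `a₁ = a₂ = a₃ = 0`). -/
theorem cert_slope₁ (u : R) : 2 * y₁ u * l₁ u = 3 * x₁ u ^ 2 - 27 * kC4 1 u := by
  simp only [x₁, y₁, l₁, kC4]; ring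
theorem cert_x₂ (u : R) : x₂ u = l₁ u ^ 2 - 2 * x₁ u := by
  simp only [x₁, x₂, l₁]; ring
theorem cert_y₂ (u : R) : y₂ u = l₁ u * (x₁ u - x₂ u) - y₁ u := by
  simp only [x₁, y₁, x₂, y₂, l₁]; ring

/-- K3 · the tangent at `2Q` and `4Q = (x₁, −y₁) = −Q`, hence `5Q = O`. -/
theorem cert_slope₂ (u : R) : 2 * y₂ u * l₂ u = 3 * x₂ u ^ 2 - 27 * kC4 1 u := by
  simp only [x₂, y₂, l₂, kC4]; ring
theorem cert_x₄ (u : R) : x₁ u = l₂ u ^ 2 - 2 * x₂ u := by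
  simp only [x₁, x₂, l₂]; ring
theorem cert_y₄ (u : R) : -y₁ u = l₂ u * (x₂ u - x₁ u) - y₂ u := by
  simp only [x₁, y₁, x₂, y₂, l₂]; ring

/-- K4 · `c₄(1,u), c₆(1,u) ∈ ℤ[u⁵]`: the rotation `u ↦ ζu` (`ζ⁵ = 1`) fixes `B_u`, so `R := Q(ζu) ∈ B_u[5]`. -/
theorem kC4_one_rot (ζ u : R) (hζ : ζ ^ 5 = 1) : kC4 1 (ζ * u) = kC4 1 u := by
  simp only [kC4]
  linear_combination (228 * u ^ 5 + 494 * u ^ 10 * (ζ ^ 5 + 1)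
    - 228 * u ^ 15 * (ζ ^ 10 + ζ ^ 5 + 1) + u ^ 20 * (ζ ^ 15 + ζ ^ 10 + ζ ^ 5 + 1)) * hζ
theorem kC6_one_rot (ζ u : R) (hζ : ζ ^ 5 = 1) : kC6 1 (ζ * u) = kC6 1 u := by
  simp only [kC6]
  linear_combination (522 * u ^ 5 + 10005 * u ^ 10 * (ζ ^ 5 + 1)
    + 10005 * u ^ 20 * (ζ ^ 15 + ζ ^ 10 + ζ ^ 5 + 1)
    - 522 * u ^ 25 * (ζ ^ 20 + ζ ^ 15 + ζ ^ 10 + ζ ^ 5 + 1)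
    - u ^ 30 * (ζ ^ 25 + ζ ^ 20 + ζ ^ 15 + ζ ^ 10 + ζ ^ 5 + 1)) * hζ

/-- K5 (XS, `ring`) · homogeneity, to pass from `(a, b)` to `(1, b/a)`. -/
theorem kC4_homog (a u : R) : kC4 a (a * u) = a ^ 20 * kC4 1 u := by simp only [kC4]; ring
theorem kC6_homog (a u : R) : kC6 a (a * u) = a ^ 30 * kC6 1 u := by simp only [kC6]; ring

set_option maxHeartbeats 4000000 in
/-- K6 (PROVED, verbatim k3, `ring`) · Klein's syzygy. -/
theorem klein_syzygy (a b : R) : kC4 a b ^ 3 - kC6 a b ^ 2 = 1728 * kD a b ^ 5 := by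
  simp only [kD, kC4, kC6]; ring

/-- K7 (S: `Polynomial.coeff` arithmetic) · the ONE coefficient that separates `R` from `⟨Q⟩`:
`[u⁸] x₁ = 36`, `[u⁸] x₂ = 72`, `[u⁸] x₁(ζu) = 36 ζ⁸ = 36 ζ³`. -/
theorem coeff8_rot_sub (ζ : 𝕃) :
    (x₁ (C ζ * X) - x₁ (X : 𝕃[X])).coeff 8 = 36 * (ζ ^ 8 - 1) ∧
    (x₁ (C ζ * X) - x₂ (X : 𝕃[X])).coeff 8 = 36 * ζ ^ 8 - 72 := by
  sorry

/-- K8 (XS) · `ζ⁵ = 1`, `ζ ≠ 1` ⟹ `ζ⁸ ≠ 1` and `36ζ⁸ ≠ 72` (else `ζ³ = 2`, `ζ¹⁵ = 32 = 1`, `31 = 0`). -/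
theorem zeta_pow_eight (ζ : 𝕃) (h5 : ζ ^ 5 = 1) (h1 : ζ ≠ 1) : ζ ^ 8 ≠ 1 ∧ 36 * ζ ^ 8 ≠ 72 := by
  have h8 : ζ ^ 8 = ζ ^ 3 := by linear_combination ζ ^ 3 * h5
  refine ⟨fun h => h1 ?_, fun h => ?_⟩
  · have h3 : ζ ^ 3 = 1 := by rw [← h8, h]
    linear_combination (-ζ) * h5 + (ζ ^ 3 + 1) * h3
  · have h3 : ζ ^ 3 = 2 := by linear_combination (1 / 36 : 𝕃) * h - h8
    have h81 : (32 : 𝕃) = 1 := by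
      linear_combination (-(ζ ^ 12 + 2 * ζ ^ 9 + 4 * ζ ^ 6 + 8 * ζ ^ 3 + 16)) * h3
        + (ζ ^ 10 + ζ ^ 5 + 1) * h5
    norm_num at h81

end Klein

/-! ## §B  The Klein curve over a field: `Q`, `R` generate 25 points of `B_u[5]` (S each) -/

section KleinCurve
variable {K : Type*} [Field K]

/-- `B_u`. -/
def kleinCurve (u : K) : WeierstrassCurve K := ⟨0, 0, 0, -27 * kC4 1 u, -54 * kC6 1 u⟩

/-- B1 (XS, `ring`) · `Δ(B_u) = 6¹² D(1,u)⁵`. -/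
theorem kleinCurve_Δ (u : K) : (kleinCurve u).Δ = 6 ^ 12 * kD 1 u ^ 5 := by
  simp only [kleinCurve, WeierstrassCurve.Δ, WeierstrassCurve.b₂, WeierstrassCurve.b₄, WeierstrassCurve.b₆,
    WeierstrassCurve.b₈, kC4, kC6, kD]
  ring

/-- B2 (S, Mathlib `Affine.Point.add_self_of_Y_ne'`, `slope_of_Y_ne`, `addX`, `addY`) · DOUBLING on a
short Weierstrass curve from a slope certificate `2yL = 3x² + A`. -/
theorem double_of_cert [CharZero K] {A B x y L : K}
    (h : (⟨0, 0, 0, A, B⟩ : WeierstrassCurve K).toAffine.Nonsingular x y) (hy : y ≠ 0)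
    (hL : 2 * y * L = 3 * x ^ 2 + A) :
    ∃ h', (.some x y h : (⟨0, 0, 0, A, B⟩ : WeierstrassCurve K).toAffine.Point) + .some x y h =
      .some (L ^ 2 - 2 * x) (L * (x - (L ^ 2 - 2 * x)) - y) h' := by
  sorry

/-- B3 (XS, `abel`/`smul` algebra) · `2Q = Q₂`, `2Q₂ = −Q` ⟹ `5Q = 0`. -/
theorem five_smul_eq_zero {A : Type*} [AddCommGroup A] {Q Q₂ : A} (h₂ : Q + Q = Q₂)
    (h₄ : Q₂ + Q₂ = -Q) : (5 : ℤ) • Q = 0 := by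
  subst h₂
  rw [show (5 : ℤ) • Q = Q + Q + (Q + Q) + Q by abel, h₄, neg_add_cancel]

/-- B4 (XS) · a nonzero polynomial does not vanish at a transcendental `u` (def. of `Transcendental`). -/
theorem aeval_ne_zero_of_transcendental {u : K} {k : Type*} [Field k] [Algebra k K]
    (hu : Transcendental k u) {p : k[X]} (hp : p ≠ 0) : aeval u p ≠ 0 :=
  fun h => hu ⟨p, hp, h⟩

/-- **B5 (S) · THE 25 POINTS.**  For `u` transcendental over `ℚ̄ ⊂ K` and `ζ` a primitive 5th root of
unity: `Q = (x₁ u, y₁ u)` and `R = (x₁(ζu), y₁(ζu))` are points of `B_u(K)` of order `5` (K1–K4, B2, B3;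
`y₁ u ≠ 0` by B4) with `R ∉ ⟨Q⟩ = {O, ±Q, ±2Q}` (x-coordinates differ: K7, K8, B4), so
`(i, j) ↦ iQ + jR` embeds `𝔽₅²`. -/
theorem kleinCurve_twentyfive [CharZero K] [Algebra 𝕃 K] (u : K) (hu : Transcendental 𝕃 u)
    (ζ : 𝕃) (h5 : ζ ^ 5 = 1) (h1 : ζ ≠ 1) :
    ∃ f : Fin 5 × Fin 5 → (kleinCurve u).toAffine.Point,
      Function.Injective f ∧ ∀ i, (5 : ℤ) • f i = 0 := by
  sorry

/-- B6 (XS, verbatim `scale_smul_short` over any field) · rescaling a short model. -/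
theorem scale_smul_short' (s : K) (hs : s ≠ 0) (A B : K) :
    (⟨Units.mk0 s⁻¹ (inv_ne_zero hs), 0, 0, 0⟩ : VariableChange K) • (⟨0, 0, 0, A, B⟩ : WeierstrassCurve K)
      = ⟨0, 0, 0, s ^ 4 * A, s ^ 6 * B⟩ := by
  ext <;> simp only [variableChange_a₁, variableChange_a₂, variableChange_a₃, variableChange_a₄,
    variableChange_a₆, Units.val_inv_eq_inv_val, Units.val_mk0, inv_inv] <;> ring

/-- B7 (XS from B5/B6 + `VariableChange.pointEquiv`) · any curve `K`-isomorphic to `B_u` by a scaling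
(possibly through `i`, `i² = −1`, absorbing a sign of `a₆`) has ≥ 25 points of order dividing 5. -/
theorem twentyfive_of_scaled_klein [CharZero K] [Algebra 𝕃 K] (u : K) (hu : Transcendental 𝕃 u)
    (W : WeierstrassCurve K) (s : K) (hs : s ≠ 0)
    (hW : W = ⟨0, 0, 0, s ^ 4 * (-27 * kC4 1 u), s ^ 6 * (-54 * kC6 1 u)⟩) :
    ∃ f : Fin 5 × Fin 5 → W.toAffine.Point, Function.Injective f ∧ ∀ i, (5 : ℤ) • f i = 0 := by
  sorry

end KleinCurve

/-! ## §F  Fisher's segment family as a curve over `F[t]`, and its generic fibre is a scaled `B_u` -/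

section Fisher
variable {R : Type*} [CommRing R] {F : Type*} [Field F]

/-- `17424·𝔠₄` and `240·17424·𝔠₆` as POLYNOMIAL expressions (tree `C4`/`C6` are field-valued with
denominators; numerators verbatim from their bodies). -/
def H4 (c₄ c₆ l m : R) : R := -(Dll c₄ c₆ l m * Dmm c₄ c₆ l m - Dlm c₄ c₆ l m ^ 2)
def H6 (c₄ c₆ l m : R) : R :=
  Dl c₄ c₆ l m * -(Dllm c₄ c₆ l m * Dmm c₄ c₆ l m + Dll c₄ c₆ l m * Dmmm c₄ c₆ l m
      - 2 * Dlm c₄ c₆ l m * Dlmm c₄ c₆ l m)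
    - Dm c₄ c₆ l m * -(Dlll c₄ c₆ l m * Dmm c₄ c₆ l m + Dll c₄ c₆ l m * Dlmm c₄ c₆ l m
      - 2 * Dlm c₄ c₆ l m * Dllm c₄ c₆ l m)

/-- F1' (XS/S, unfold + `field_simp`) · `𝔠₄ = H4/17424`, `𝔠₆ = H6/(240·17424)`. -/
theorem C4_eq_H4_div (c₄ c₆ l m : F) : C4 c₄ c₆ l m = H4 c₄ c₆ l m / 17424 := by
  simp only [C4, H4]
theorem C6_eq_H6_div [CharZero F] (c₄ c₆ l m : F) : C6 c₄ c₆ l m = H6 c₄ c₆ l m / (240 * 17424) := by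
  simp only [C6, C4l, C4m, H6]
  ring

/-- THE FAMILY `𝒢 / F[t]` along Fisher's segment `(λ : μ) = (1 − t + tl : tm)`. -/
noncomputable def segFamily (c₄ c₆ l m : F) : WeierstrassCurve F[X] :=
  ⟨0, 0, 0, C (-27 / 17424) * H4 (C c₄) (C c₆) (1 - X + X * C l) (X * C m),
    C (-54 / (240 * 17424)) * H6 (C c₄) (C c₆) (1 - X + X * C l) (X * C m)⟩

/-- F2 (S, `map_*` simp lemmas + F1') · the fibres are the members of Fisher's Hesse family. -/
theorem segFamily_fibre [CharZero F] (c₄ c₆ l m t : F) :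
    (segFamily c₄ c₆ l m).map (evalRingHom t) =
      ⟨0, 0, 0, -27 * C4 c₄ c₆ (1 - t + t * l) (t * m), -54 * C6 c₄ c₆ (1 - t + t * l) (t * m)⟩ := by
  sorry

/-- F3 (XS, F2 + tree `C4_one_zero`/`C6_one_zero` re-proved over `F` by `ring`) · `𝒢_0 = E`, `𝒢_1 = E'`. -/
theorem segFamily_fibre_zero [CharZero F] (c₄ c₆ l m : F) :
    (segFamily c₄ c₆ l m).map (evalRingHom 0) = ⟨0, 0, 0, -27 * c₄, -54 * c₆⟩ := by
  sorry
theorem segFamily_fibre_one [CharZero F] (c₄ c₆ l m : F) :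
    (segFamily c₄ c₆ l m).map (evalRingHom 1) = ⟨0, 0, 0, -27 * C4 c₄ c₆ l m, -54 * C6 c₄ c₆ l m⟩ := by
  sorry

/-- F4 (XS, `map_*`) · base change `ℚ → ℚ̄` of the family (so §G applies with `𝒲₀ = segFamily c₄ c₆ l m`). -/
theorem segFamily_map (c₄ c₆ l m : ℚ) :
    (segFamily c₄ c₆ l m).map (Polynomial.mapRingHom (algebraMap ℚ 𝕃)) =
      segFamily (c₄ : 𝕃) (c₆ : 𝕃) (l : 𝕃) (m : 𝕃) := by
  sorry

/-- F5 (PROVED k3-g10 `lemma84_C4`, generic field, restated) · Fisher Lemma 8.4 for `𝔠₄`. -/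
theorem lemma84_C4 [CharZero F] (a b l m : F) (hD : kD a b ≠ 0) :
    C4 (kC4 a b) (kC6 a b) l m = kC4 (Mv1 a b l m) (Mv2 a b l m) := by
  sorry

/-- F6 (PROVED k3-g9 `lemma84_D` by `ring`, restated) · Fisher Lemma 8.4 for `𝔇`. -/
theorem lemma84_D (a b l m : F) : D (kC4 a b) (kC6 a b) l m * kD a b = kD (Mv1 a b l m) (Mv2 a b l m) := by
  sorry

/-- F7 (PROVED k3-g11 `hesse_syzygy_F` at `m = 1`, 70 s; general `(l, m)` by the same `ring` or by
homogeneity `N4_smul/N6_smul`; restated) · Fisher (8.1). -/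
theorem hesse_syzygy [CharZero F] (c₄ c₆ l m : F) :
    C4 c₄ c₆ l m ^ 3 - C6 c₄ c₆ l m ^ 2 = (c₄ ^ 3 - c₆ ^ 2) * D c₄ c₆ l m ^ 5 := by
  sorry

/-- F8 (PROVED k3-g10 `exists_torsorPoint`, restated) · torsor points exist over an algebraically closed field. -/
theorem exists_torsorPoint [IsAlgClosed F] [CharZero F] (c₄ c₆ : F) (h : c₄ ^ 3 ≠ c₆ ^ 2) :
    ∃ a b : F, kC4 a b = c₄ ∧ kC6 a b = c₆ := by
  sorry

/-- **F9 (S) · LEMMA 8.4 UP TO SIGN, over any char-0 field** (here `K = ℚ̄(t)`): from F5, F6, F7 and K6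
the squares of `𝔠₆(λ,μ)` and `c₆^{Kl}(M_v(λ,μ))` agree, so they agree up to a sign `ε`.  (This replaces
k3's OPEN `L84C6`; the sign is absorbed in F10 by the scaling through `i`.) -/
theorem lemma84_C6_upToSign [CharZero F] (a b l m : F) (hD : kD a b ≠ 0) :
    ∃ ε : F, ε ^ 2 = 1 ∧ C6 (kC4 a b) (kC6 a b) l m = ε * kC6 (Mv1 a b l m) (Mv2 a b l m) := by
  sorry

/-- **F10 (S/M−) · THE GENERIC FIBRE IS A SCALED KLEIN CURVE.**  Over `K = ℚ̄(t)`, with a torsor point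
`v = (a, b)` of `(c₄, c₆)` and `m ≠ 0`: `A := M_v(λ,μ)₁`, `B := M_v(λ,μ)₂` (`λ = 1 − t + tl`, `μ = tm`),
`A ≠ 0`, `u := B/A` is TRANSCENDENTAL over `ℚ̄` (non-constant: `det(v, M_v(l,m)) = 12 m D(v) ≠ 0`,
Mathlib `RatFunc.transcendental_of_ne_C`), and `𝒢_K = ⟨0,0,0, s⁴(−27c₄(1,u)), s⁶(−54c₆(1,u))⟩` with
`s = A⁵` or `s = i·A⁵` (F2 read in `K`, F5, F9, K5). -/
theorem genericFibre_eq_scaled_klein (c₄ c₆ l m a b : 𝕃) (hm : m ≠ 0) (h4 : kC4 a b = c₄)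
    (h6 : kC6 a b = c₆) (hD : kD a b ≠ 0) :
    ∃ (u s : RatFunc 𝕃), Transcendental 𝕃 u ∧ s ≠ 0 ∧
      (segFamily c₄ c₆ l m).map (algebraMap 𝕃[X] (RatFunc 𝕃)) =
        ⟨0, 0, 0, s ^ 4 * (-27 * kC4 1 u), s ^ 6 * (-54 * kC6 1 u)⟩ := by
  sorry

end Fisher

/-! ## §C  Counting and gluing (S) -/

section Count

/-- C1 (S, `Nat.card` + `Finite.of_injective`) · an additive map injective on `n`-torsion into a group whose
`n`-torsion has `N` elements, whose source has `N` distinct `n`-torsion elements, is BIJECTIVE on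
`n`-torsion and induces `A[n] ≃+ B[n]`. -/
theorem torsionEquiv_of_injOn_of_card {A B : Type*} [AddCommGroup A] [AddCommGroup B] (f : A →+ B)
    (n : ℤ) (N : ℕ) (hinj : Set.InjOn f {P | n • P = 0})
    (hB : Nat.card (AddSubgroup.torsionBy B n) = N) [Finite (AddSubgroup.torsionBy B n)]
    (hA : ∃ g : Fin N → A, Function.Injective g ∧ ∀ i, n • g i = 0) :
    ∃ e : AddSubgroup.torsionBy A n ≃+ AddSubgroup.torsionBy B n, ∀ P, (e P : B) = f P := by
  sorry

end Count

/-! ## §A  ASSEMBLY -/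

/-- **A1 (M, pure glue of the items above) · F1 = Fisher 13.2 (i).**
`m = 0`: `E' = ⟨(l⁵)⁻¹,0,0,0⟩ • E` (`𝔠₄(l,0) = l²⁰c₄`, `𝔠₆(l,0) = l³⁰c₆`, `l ≠ 0` from `E'.IsElliptic`),
`congr_of_smul_eq`.  `m ≠ 0`: `𝒲₀ := segFamily c₄ c₆ l m`, `𝒲 := famL 𝒲₀ = segFamily ↑c₄ …` (F4); torsor
point (F8, `c₄³ ≠ c₆²` ⟸ `E.IsElliptic`); F10 + B7 give 25 points of `𝒲(K)[5]`; for `t₀ ∈ {0, 1}`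
(`Δ ≠ 0` ⟸ `E`, `E'` elliptic via F3/G4) S7 + C1 + `card_torsionBy_eq_sq` (= 25 over `ℚ̄`) give
`e_{t₀} : 𝒲(K)[5] ≃+ 𝒲_{t₀}(ℚ̄)[5]`, equivariant by G5 (w.r.t. `galPoint`); `e := e₀ ∘ e₁⁻¹`, transported
along `congrEquiv` (F3, G4: `𝒲_{0} = E_{ℚ̄}`, `𝒲_{1} = E'_{ℚ̄}`), is additive and `Γ_ℚ`-equivariant. -/
theorem thm132_of_specialisation : thm132_geomTorsionFive_of_hesseFamily := by
  sorry

/-- **THE STUB.**  With k3-g11's kernel-checked road `CDT_three_five_switch_of_thm132 : F1 →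
CDT_three_five_switch` (0 sorries; entering as the hypothesis `road` since crux workfiles do not import
each other) and `stub_switch ↔ CDT_three_five_switch` (`Iff.rfl`), the registered stub follows from A1. -/
theorem stub_switch_of_specialisation
    (road : thm132_geomTorsionFive_of_hesseFamily → CDT_three_five_switch) : CDT_three_five_switch :=
  road thm132_of_specialisation

end Summit.ABC.ABC.Cruxes.FreyModularity.StubSwitchK1g14

end
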